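import Summits.QuantumFields.YangMills.Theorems.BalabanUVNodesN15PerCubeGreenFineTransport
import Summits.QuantumFields.YangMills.Theorems.BalabanUVNodesN15CurvedGluingLocalGaugesUN
import Summits.QuantumFields.YangMills.Theorems.BalabanUVNodesN15CurvedGluingLocalGaugesSpeciesUN
import Summits.QuantumFields.YangMills.Theorems.BalabanUVNodesN15CurvedGluingCubeDressedGeneralGauge
import HarnessLib

/-!
# N15 = NE2, road (c) — PROGRAMME (PC) «[B9] Sect. C FOR THE LANDAU LETTER WITH PER-CUBE GAUGES (3.35) AS PRINTED», (PC-E), (m3) OF `PCE-DESIGN-g31`: THE η-DEFECT OF BAŁABAN's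
# OPERATOR THROUGH GAUGE-TWISTED TRANSPORTS IS THE GAUGE-TWIST OF THE η-DEFECT — `𝔇_{W′τWᵀ}(A′(U′^{u′}), A(U^{u})) = M_{W′}·𝔇_τ(A′(U′), A(U))·M_{Wᵀ}` on the two grids of the
# pairing, for ARBITRARY transports `τ`, hence block majorants of the defect are gauge-invariant up to `|ι|²` (dag-n15-c g31, n15-c∕330)

Cell `pub-ymgap`, seat `pub-ymgap-dag-n15-c` (generation g31; R134 (a) seat, strategy s1 «first missing estimate»; HUMAN RULING D-0062; chair R424 venue).
`bears_on: R4∕N15 · K3⁸ SpineGivenEndpointR13SepCoPHV (stmt-QuantumFields-27366)`; filed `--kind proof --supports stmt-QuantumFields-27366 --as helper` — COUNT-NEUTRAL.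
Five theorems, 0 `def`, 0 `sorry`; ALGEBRA over landed gauge laws, NO estimate.  Imports BY NAME n15-c∕327 `…PerCubeGreenFineTransport` (the two grids' bond objects `CvX`∕`cvNL`∕
`cvNVq`∕`cvNVr`∕`cvGauge` and `CvX'`∕`cvNL'`∕`cvNVq'`∕`cvNVr'`, `cvBlk_comp_kingPrV`, and through n15-c∕201 `cv_hP_live` = the gauge law of the summand `N_L − N_V^Q − N_V^R`),
dag-n15-w3∕n15-c `…CurvedGluingLocalGaugesUN` (`localOp_eq_covLapM_trGaugeActFwd_add` = (3.34) for the covariant Laplacian), `…CurvedGluingLocalGaugesSpeciesUN`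
(`uN_trGaugeActFwd_conj_field`: the `U(m)` gauge action in trace-form coordinates), `…CurvedGluingCubeDressedGeneralGauge` (`hasMaj_mmulOp_comp_of_entry_le_one`,
`hasMaj_comp_mmulOp_of_entry_le_one`, `entry_le_one_of_orthogonal`); pub-balaban `T4EtaRateDefect.idef` through the closure.  Nothing in the tree is modified, no landed name
re-declared.

WHY (director-ym RULING (PC-E) I.20786 2026-08-30T22:21:49Z: TRANSPORT = COVARIANT, architecture = `PCE-DESIGN-g31.md` §2–§3; this is its item (m3)).  The covariant two-grid
pull-back `τ_{U′}` (dag-n15-a g37, items (m1)–(m2)) obeys the gauge law `τ_{U′^{u′}} = M_{W′}·τ_{U′}·M_{Wᵀ}` for paired gauges (`W′ = Ad u′`, `W = Ad u` in trace-form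
coordinates).  THIS FILE proves, for an ARBITRARY pair of linear transports `τ₁, τ₂ : (coarse 1-forms) → (fine 1-forms)` (so independently of (m1)'s final shape), that the
η-defect `𝔇_τ(A′, A) = A′τ₁ − τ₂A` of Bałaban's operators `A(U) = Δ_{R_U} + N_L − N_V^Q(U) − N_V^R(U)` on the two grids transforms under `(U′, U, τᵢ) ↦ (U′^{u′}, U^{u},
M_{W′}τᵢM_{Wᵀ})` by CONJUGATION: `𝔇 ↦ M_{W′}·𝔇·M_{Wᵀ}` — from the single-grid gauge law `M_W A(U) M_{Wᵀ} = A(U^u)` ((3.34): `localOp_eq_covLapM_trGaugeActFwd_add` +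
`uN_trGaugeActFwd_conj_field` for the covariant Laplacian, `cv_hP_live` for the summand) on the coarse grid (§2), its fine edition by n15-c∕327's transport (§2), and three lines
of algebra (§1 `idef_conj`: the defect of conjugated operators through conjugated transports is the conjugated defect, the inner conjugators cancelling).  Consequence (§4):
`HasMaj` rows of the operator defect — the «consistency» input of n15-c∕328 `idef_inverse_of_reg335Cube_twoGrid` — are gauge-invariant up to the colour constant `|ι|²` (the
block norm is the sup over colour COMPONENTS, not rotation-invariant exactly), so the defect row of (PC-E) may be computed box by box in the cube gauge pair of r06's `Reg335Cube`,
where both fields carry the (3.35) letters (memo §2 (a)).  With the FLAT pull-back `τ = pull` the same algebra holds but `M_{W′}·pull·M_{Wᵀ} ≠ pull` unless `W′ = W∘π` (block-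
constant fine gauge): that is the refuted convention (ruling; memo §2 witness).

WHAT THIS FILE PROVES (kernel).
* §1 `idef_conj` [folklore]: `idef (P₁′τ₁Q₁) (P₂′τ₂Q₂) (P₂′A′Q₁′) (P₂AQ₁) = P₂′ ∘ idef τ₁ τ₂ A′ A ∘ Q₁` when `Q₁′P₁′ = 1`, `Q₂P₂ = 1` (any linear maps).
* §2 ★★ `cvOp_gauge` (coarse grid, spacing parameter `η` free): `M_W ∘ A(U) ∘ M_{Wᵀ} = A(U^{u})` for Bałaban's full bond operator, `U^{u} = cvGauge (u∘fst) U`, `W = Ad u` (`u`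
  a unitary SITE field); ★★ `cvOp'_gauge`: the same on the fine grid (objects `cvNL'`∕`cvNVq'`∕`cvNVr'`, shifts `bshiftEquiv (cvM) (L^rL^k)`), by transport from index `r + k`.
* §3 ★★★ `idef_cvOp_gauge`: `idef (M_{W′}τ₁M_{Wᵀ}) (M_{W′}τ₂M_{Wᵀ}) (A′(U′^{u′})) (A(U^{u})) = M_{W′} ∘ idef τ₁ τ₂ (A′(U′)) (A(U)) ∘ M_{Wᵀ}` for ALL linear `τ₁ τ₂`.
* §4 ★★★ `hasMaj_idef_cvOp_gauge`: `HasMaj b_c b_f (idef τ₁ τ₂ A′ A) K`, `K ≥ 0` ⟹ `HasMaj b_c b_f (idef (M_{W′}τ₁M_{Wᵀ}) (M_{W′}τ₂M_{Wᵀ}) A′(U′^{u′}) A(U^{u})) (|ι|²·K)` in the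
  two grids' bond block norms (`CvNorm`, and `cvBlk ∘ kingPrV` on the fine side).

HONEST FRAMING ∕ LIMITS.  Algebra + the landed sandwich bookkeeping; no estimate; no pairing between `U` and `U′` and no transport is constructed here (τ₁, τ₂ arbitrary; the
covariant `τ_{U′}` is dag-n15-a's (m1)); MODEL carriers (doubled-cube torus cover, one averaging level, unit weights, trace-form colour coordinates `e`); [Balaban1985BackgroundPropagators]
(3.34)–(3.35) p.396, (3.50) p.400, Thm 3.14 pp.426–427 = SHAPES ∕ MECHANISM, nothing printed is asserted.  NE2⁺ NOT PRINTED, NOT proved; N15 of record untouched (DISCHARGED AS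
CONSUMED, p687738); K3⁸ OPEN; counts of record UNMOVED (typed 28∕28 · discharged 8∕27); one finite 𝕋⁴ at fixed ε per index — NOT infinite volume, NOT OS on ℝ⁴, NOT a mass
gap, NOT Clay; R4 closes the conditional finite-𝕋⁴ rung `BalabanLadder.UV` only.  Restate-immune (no Theses import).
-/

noncomputable section

open scoped BigOperators Matrix Matrix.Norms.L2Operator

namespace Summit.QuantumFields.YangMills.BalabanUVNodes.N15.Gluing

open Real
open Literature.MathematicalPhysics.QuantumFieldTheory.Balaban1983to89
open Literature.MathematicalPhysics.QuantumFieldTheory.Balaban1983to89.B5Prop11Plancherel (Tor fine unitVec)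
open Literature.MathematicalPhysics.QuantumFieldTheory.Balaban1983to89.B11SectG (BlockNorm HasMaj)
open Literature.MathematicalPhysics.QuantumFieldTheory.Balaban1983to89.B6UnitTorusCarrier (unitTorusGeo)
open Literature.MathematicalPhysics.QuantumFieldTheory.Balaban1983to89.T4EtaRateDefect (idef)
open Literature.MathematicalPhysics.QuantumFieldTheory.King1986.Torus (blockOf)
open Literature.Barriers.QuantumFields (traceForm)
open Summit.QuantumFields.YangMills.BalabanUVNodes.N15.BackgroundLayer (covLapM)
open Summit.QuantumFields.YangMills.BalabanUVNodes.N15.MatrixSpecies (mmulOp coordMat liftBlk)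
open Summit.QuantumFields.YangMills.BalabanUVNodes.N15.VectorPiece (bshiftEquiv kingPrV)
open Summit.QuantumFields.YangMills.BalabanUVNodes.N15.CurvedSpecies (gaugePair trGaugeActFwd localOp_eq_covLapM_trGaugeActFwd_add uN_trGaugeActFwd_conj_field
  uN_coordMat_conj_orthogonal mmulOp_transpose_comp hasMaj_mmulOp_comp_of_entry_le_one hasMaj_comp_mmulOp_of_entry_le_one entry_le_one_of_orthogonal)

variable {d : ℕ} {L : ℕ} [NeZero L]

/-! ## §1 The defect of conjugated operators through conjugated transports -/

section Algebra

variable {F₁ F₂ F₁' F₂' : Type} [AddCommGroup F₁] [Module ℝ F₁] [AddCommGroup F₂] [Module ℝ F₂] [AddCommGroup F₁'] [Module ℝ F₁'] [AddCommGroup F₂'] [Module ℝ F₂']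

/-- `𝔇` of conjugated operators through conjugated transports is the conjugated `𝔇`: `idef (P₁′τ₁Q₁) (P₂′τ₂Q₂) (P₂′A′Q₁′) (P₂AQ₁) = P₂′ ∘ idef τ₁ τ₂ A′ A ∘ Q₁` once the inner
factors cancel (`Q₁′P₁′ = 1`, `Q₂P₂ = 1`). [folklore] -/
theorem idef_conj (τ₁ : F₁ →ₗ[ℝ] F₁') (τ₂ : F₂ →ₗ[ℝ] F₂') (A' : F₁' →ₗ[ℝ] F₂') (A : F₁ →ₗ[ℝ] F₂)
    (P₁' Q₁' : F₁' →ₗ[ℝ] F₁') (P₂' : F₂' →ₗ[ℝ] F₂') (P₂ Q₂ : F₂ →ₗ[ℝ] F₂) (Q₁ : F₁ →ₗ[ℝ] F₁)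
    (h₁' : Q₁' ∘ₗ P₁' = LinearMap.id) (h₂ : Q₂ ∘ₗ P₂ = LinearMap.id) :
    idef (P₁' ∘ₗ τ₁ ∘ₗ Q₁) (P₂' ∘ₗ τ₂ ∘ₗ Q₂) (P₂' ∘ₗ A' ∘ₗ Q₁') (P₂ ∘ₗ A ∘ₗ Q₁) = P₂' ∘ₗ idef τ₁ τ₂ A' A ∘ₗ Q₁ := by
  have e1 : ∀ x, Q₁' (P₁' x) = x := fun x => by simpa using LinearMap.congr_fun h₁' x
  have e2 : ∀ x, Q₂ (P₂ x) = x := fun x => by simpa using LinearMap.congr_fun h₂ x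
  ext μ
  simp [idef, map_sub, e1, e2]

end Algebra

/-! ## §2 The gauge law of Bałaban's full operator on each grid -/

section GaugeLaw

variable {ι : Type} [Fintype ι] [DecidableEq ι] {mm : Type} [Fintype mm] [DecidableEq mm] (e : Matrix mm mm ℂ ≃L[ℝ] (ι → ℝ))

/-- ★★ **`M_W ∘ A(U) ∘ M_{Wᵀ} = A(U^u)`** for Bałaban's full bond operator `A(U) = Δ_{R_U} + (N_L − N_V^Q(U) − N_V^R(U))` on the coarse grid: (3.34) for the covariant Laplacian
(`localOp_eq_covLapM_trGaugeActFwd_add` + `uN_trGaugeActFwd_conj_field`) and n15-c∕201 `cv_hP_live` for the summand; `u₀` a unitary site field, `W = Ad u₀` in trace-form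
coordinates, `U^u_μ(p) = u₀(p)·U_μ(p)·u₀(p + e_μ)ᴴ` (= `cvGauge (u₀∘fst) U`, written out); the spacing parameter `η` is free. [cite: Balaban1985BackgroundPropagators, (3.34) p.396, (3.50) p.400] -/
theorem cvOp_gauge (mv kk : ℕ) (hL : Odd L ∧ 1 < L) (a η : ℝ) (he : ∀ A B : Matrix mm mm ℂ, traceForm A B = e A ⬝ᵥ e B)
    {u₀ : ScX d L mv kk hL → Matrix mm mm ℂ} (hu : ∀ x, (u₀ x)ᴴ * u₀ x = 1) (U : Fin (d + 1) → CvX d L mv kk hL → Matrix mm mm ℂ) :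
    mmulOp (fun p : CvX d L mv kk hL => coordMat e (ContinuousLinearMap.mulLeftRight ℝ (Matrix mm mm ℂ) (u₀ p.1) (u₀ p.1)ᴴ)) ∘ₗ
        (covLapM (bshiftEquiv (cvM d L mv kk hL) (L ^ kk)) η (gaugePair (bshiftEquiv (cvM d L mv kk hL) (L ^ kk)) (fun μ x => coordMat e (ContinuousLinearMap.mulLeftRight ℝ (Matrix mm mm ℂ) (U μ x) (U μ x)ᴴ))) + (cvNL d L mv kk hL a ι - cvNVq d L mv kk hL a ι e (U) - cvNVr d L mv kk hL a ι e (U))) ∘ₗ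
        mmulOp (fun p : CvX d L mv kk hL => (coordMat e (ContinuousLinearMap.mulLeftRight ℝ (Matrix mm mm ℂ) (u₀ p.1) (u₀ p.1)ᴴ))ᵀ) =
      covLapM (bshiftEquiv (cvM d L mv kk hL) (L ^ kk)) η (gaugePair (bshiftEquiv (cvM d L mv kk hL) (L ^ kk)) (fun μ x => coordMat e (ContinuousLinearMap.mulLeftRight ℝ (Matrix mm mm ℂ) ((fun μ p => u₀ p.1 * U μ p * (u₀ ((bshiftEquiv (cvM d L mv kk hL) (L ^ kk)) μ p).1)ᴴ) μ x) ((fun μ p => u₀ p.1 * U μ p * (u₀ ((bshiftEquiv (cvM d L mv kk hL) (L ^ kk)) μ p).1)ᴴ) μ x)ᴴ))) + (cvNL d L mv kk hL a ι - cvNVq d L mv kk hL a ι e ((fun μ p => u₀ p.1 * U μ p * (u₀ ((bshiftEquiv (cvM d L mv kk hL) (L ^ kk)) μ p).1)ᴴ)) - cvNVr d L mv kk hL a ι e ((fun μ p => u₀ p.1 * U μ p * (u₀ ((bshiftEquiv (cvM d L mv kk hL) (L ^ kk)) μ p).1)ᴴ))) := by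
  have hW := fun p : CvX d L mv kk hL => uN_coordMat_conj_orthogonal e he (hu p.1)
  rw [localOp_eq_covLapM_trGaugeActFwd_add (η := η) (τ := bshiftEquiv (cvM d L mv kk hL) (L ^ kk)) (W := fun p : CvX d L mv kk hL => coordMat e (ContinuousLinearMap.mulLeftRight ℝ (Matrix mm mm ℂ) (u₀ p.1) (u₀ p.1)ᴴ))
    (R := fun μ x => coordMat e (ContinuousLinearMap.mulLeftRight ℝ (Matrix mm mm ℂ) (U μ x) (U μ x)ᴴ)) (fun p => (hW p).2)]
  -- the `U(m)` gauge action in trace-form coordinates (dag-n15-w3's lemma, restated in this file's instance path)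
  have h2 : trGaugeActFwd (bshiftEquiv (cvM d L mv kk hL) (L ^ kk)) (fun p : CvX d L mv kk hL => coordMat e (ContinuousLinearMap.mulLeftRight ℝ (Matrix mm mm ℂ) (u₀ p.1) (u₀ p.1)ᴴ)) (fun μ x => coordMat e (ContinuousLinearMap.mulLeftRight ℝ (Matrix mm mm ℂ) (U μ x) (U μ x)ᴴ)) =
      fun μ x => coordMat e (ContinuousLinearMap.mulLeftRight ℝ (Matrix mm mm ℂ) (u₀ x.1 * U μ x * (u₀ ((bshiftEquiv (cvM d L mv kk hL) (L ^ kk)) μ x).1)ᴴ) (u₀ x.1 * U μ x * (u₀ ((bshiftEquiv (cvM d L mv kk hL) (L ^ kk)) μ x).1)ᴴ)ᴴ) :=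
    uN_trGaugeActFwd_conj_field e (bshiftEquiv (cvM d L mv kk hL) (L ^ kk)) (fun p : CvX d L mv kk hL => u₀ p.1) U he (fun p => hu p.1)
  rw [h2]
  have h3 := cv_hP_live mv kk hL a e he (u₀ := fun _ : Unit => u₀) (fun _ x => hu x) U ()
  rw [h3, sub_sub]
  rfl

/-- ★★ **THE SAME ON THE FINE GRID** (spacing `L^{−r}L^{−k}`, objects `cvNL'`∕`cvNVq'`∕`cvNVr'`, the gauge action written out): n15-c∕327's transport of `cvOp_gauge` from index `r + k`.
[cite: Balaban1985BackgroundPropagators, (3.34) p.396, (3.50) p.400] -/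
theorem cvOp'_gauge (mv kk r : ℕ) (hL : Odd L ∧ 1 < L) (a' η' : ℝ) (he : ∀ A B : Matrix mm mm ℂ, traceForm A B = e A ⬝ᵥ e B)
    {u₀' : ScX' d L mv kk r hL → Matrix mm mm ℂ} (hu' : ∀ x, (u₀' x)ᴴ * u₀' x = 1) (U' : Fin (d + 1) → CvX' d L mv kk r hL → Matrix mm mm ℂ) :
    mmulOp (fun p : CvX' d L mv kk r hL => coordMat e (ContinuousLinearMap.mulLeftRight ℝ (Matrix mm mm ℂ) (u₀' p.1) (u₀' p.1)ᴴ)) ∘ₗ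
        (covLapM (bshiftEquiv (cvM d L mv kk hL) (L ^ r * L ^ kk)) η' (gaugePair (bshiftEquiv (cvM d L mv kk hL) (L ^ r * L ^ kk)) (fun μ x => coordMat e (ContinuousLinearMap.mulLeftRight ℝ (Matrix mm mm ℂ) (U' μ x) (U' μ x)ᴴ))) + (cvNL' d L mv kk r hL a' ι - cvNVq' d L mv kk r hL a' ι e (U') - cvNVr' d L mv kk r hL a' ι e (U'))) ∘ₗ
        mmulOp (fun p : CvX' d L mv kk r hL => (coordMat e (ContinuousLinearMap.mulLeftRight ℝ (Matrix mm mm ℂ) (u₀' p.1) (u₀' p.1)ᴴ))ᵀ) =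
      covLapM (bshiftEquiv (cvM d L mv kk hL) (L ^ r * L ^ kk)) η' (gaugePair (bshiftEquiv (cvM d L mv kk hL) (L ^ r * L ^ kk)) (fun μ x => coordMat e (ContinuousLinearMap.mulLeftRight ℝ (Matrix mm mm ℂ) ((fun μ p => u₀' p.1 * U' μ p * (u₀' ((bshiftEquiv (cvM d L mv kk hL) (L ^ r * L ^ kk)) μ p).1)ᴴ) μ x) ((fun μ p => u₀' p.1 * U' μ p * (u₀' ((bshiftEquiv (cvM d L mv kk hL) (L ^ r * L ^ kk)) μ p).1)ᴴ) μ x)ᴴ))) + (cvNL' d L mv kk r hL a' ι - cvNVq' d L mv kk r hL a' ι e ((fun μ p => u₀' p.1 * U' μ p * (u₀' ((bshiftEquiv (cvM d L mv kk hL) (L ^ r * L ^ kk)) μ p).1)ᴴ)) - cvNVr' d L mv kk r hL a' ι e ((fun μ p => u₀' p.1 * U' μ p * (u₀' ((bshiftEquiv (cvM d L mv kk hL) (L ^ r * L ^ kk)) μ p).1)ᴴ))) := by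
  obtain H := @cvOp_gauge d L _ ι _ _ mm _ _ e mv (r + kk) hL a' η' he
  delta cvNVr cvNVq cvNL at H
  delta cvLandau at H
  delta CvX ScX at H
  delta cvNVr' cvNVq' cvNL'
  delta cvLandau'
  generalize_proofs p0 p1 p2 p3 p4 p5 p6 p7 p8 p9 p10 p11 p12 p13 p14 p15 p16 p17 p18 p19 at H
  revert p15 p17 p18 p19 H
  rw [show L ^ (r + kk) = L ^ r * L ^ kk from pow_add L r kk]
  intro p15 p17 p18 p19 H
  exact H hu' U'

end GaugeLaw

/-! ## §3 The η-defect through gauge-twisted transports is the gauge-twist of the η-defect -/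

section Defect

variable {ι : Type} [Fintype ι] [DecidableEq ι] {mm : Type} [Fintype mm] [DecidableEq mm] (e : Matrix mm mm ℂ ≃L[ℝ] (ι → ℝ))

/-- ★★★ **`𝔇_{W′τWᵀ}(A′(U′^{u′}), A(U^{u})) = M_{W′}·𝔇_τ(A′(U′), A(U))·M_{Wᵀ}`** — for ALL linear transports `τ₁, τ₂` from coarse to fine coloured 1-forms and all unitary site gauges
`u₀` (coarse), `u₀′` (fine): the η-defect of Bałaban's operators on the two grids of the pairing transforms by conjugation when fields and transports are gauge-twisted together
(§2 on both grids + §1). [cite: Balaban1985BackgroundPropagators, (3.34) p.396, Thm 3.14 pp.426–427 (difference template: shape); King1986, p.664 (pairing)] -/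
theorem idef_cvOp_gauge (mv kk r : ℕ) (hL : Odd L ∧ 1 < L) (a η a' η' : ℝ) (he : ∀ A B : Matrix mm mm ℂ, traceForm A B = e A ⬝ᵥ e B)
    {u₀ : ScX d L mv kk hL → Matrix mm mm ℂ} (hu : ∀ x, (u₀ x)ᴴ * u₀ x = 1) (U : Fin (d + 1) → CvX d L mv kk hL → Matrix mm mm ℂ)
    {u₀' : ScX' d L mv kk r hL → Matrix mm mm ℂ} (hu' : ∀ x, (u₀' x)ᴴ * u₀' x = 1) (U' : Fin (d + 1) → CvX' d L mv kk r hL → Matrix mm mm ℂ)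
    (τ₁ τ₂ : (CvX d L mv kk hL × ι → ℝ) →ₗ[ℝ] (CvX' d L mv kk r hL × ι → ℝ)) :
    idef (mmulOp (fun p : CvX' d L mv kk r hL => coordMat e (ContinuousLinearMap.mulLeftRight ℝ (Matrix mm mm ℂ) (u₀' p.1) (u₀' p.1)ᴴ)) ∘ₗ τ₁ ∘ₗ mmulOp (fun p : CvX d L mv kk hL => (coordMat e (ContinuousLinearMap.mulLeftRight ℝ (Matrix mm mm ℂ) (u₀ p.1) (u₀ p.1)ᴴ))ᵀ)) (mmulOp (fun p : CvX' d L mv kk r hL => coordMat e (ContinuousLinearMap.mulLeftRight ℝ (Matrix mm mm ℂ) (u₀' p.1) (u₀' p.1)ᴴ)) ∘ₗ τ₂ ∘ₗ mmulOp (fun p : CvX d L mv kk hL => (coordMat e (ContinuousLinearMap.mulLeftRight ℝ (Matrix mm mm ℂ) (u₀ p.1) (u₀ p.1)ᴴ))ᵀ))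
        (covLapM (bshiftEquiv (cvM d L mv kk hL) (L ^ r * L ^ kk)) η' (gaugePair (bshiftEquiv (cvM d L mv kk hL) (L ^ r * L ^ kk)) (fun μ x => coordMat e (ContinuousLinearMap.mulLeftRight ℝ (Matrix mm mm ℂ) ((fun μ p => u₀' p.1 * U' μ p * (u₀' ((bshiftEquiv (cvM d L mv kk hL) (L ^ r * L ^ kk)) μ p).1)ᴴ) μ x) ((fun μ p => u₀' p.1 * U' μ p * (u₀' ((bshiftEquiv (cvM d L mv kk hL) (L ^ r * L ^ kk)) μ p).1)ᴴ) μ x)ᴴ))) + (cvNL' d L mv kk r hL a' ι - cvNVq' d L mv kk r hL a' ι e ((fun μ p => u₀' p.1 * U' μ p * (u₀' ((bshiftEquiv (cvM d L mv kk hL) (L ^ r * L ^ kk)) μ p).1)ᴴ)) - cvNVr' d L mv kk r hL a' ι e ((fun μ p => u₀' p.1 * U' μ p * (u₀' ((bshiftEquiv (cvM d L mv kk hL) (L ^ r * L ^ kk)) μ p).1)ᴴ))))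
        (covLapM (bshiftEquiv (cvM d L mv kk hL) (L ^ kk)) η (gaugePair (bshiftEquiv (cvM d L mv kk hL) (L ^ kk)) (fun μ x => coordMat e (ContinuousLinearMap.mulLeftRight ℝ (Matrix mm mm ℂ) ((fun μ p => u₀ p.1 * U μ p * (u₀ ((bshiftEquiv (cvM d L mv kk hL) (L ^ kk)) μ p).1)ᴴ) μ x) ((fun μ p => u₀ p.1 * U μ p * (u₀ ((bshiftEquiv (cvM d L mv kk hL) (L ^ kk)) μ p).1)ᴴ) μ x)ᴴ))) + (cvNL d L mv kk hL a ι - cvNVq d L mv kk hL a ι e ((fun μ p => u₀ p.1 * U μ p * (u₀ ((bshiftEquiv (cvM d L mv kk hL) (L ^ kk)) μ p).1)ᴴ)) - cvNVr d L mv kk hL a ι e ((fun μ p => u₀ p.1 * U μ p * (u₀ ((bshiftEquiv (cvM d L mv kk hL) (L ^ kk)) μ p).1)ᴴ)))) =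
      mmulOp (fun p : CvX' d L mv kk r hL => coordMat e (ContinuousLinearMap.mulLeftRight ℝ (Matrix mm mm ℂ) (u₀' p.1) (u₀' p.1)ᴴ)) ∘ₗ
        idef τ₁ τ₂ (covLapM (bshiftEquiv (cvM d L mv kk hL) (L ^ r * L ^ kk)) η' (gaugePair (bshiftEquiv (cvM d L mv kk hL) (L ^ r * L ^ kk)) (fun μ x => coordMat e (ContinuousLinearMap.mulLeftRight ℝ (Matrix mm mm ℂ) (U' μ x) (U' μ x)ᴴ))) + (cvNL' d L mv kk r hL a' ι - cvNVq' d L mv kk r hL a' ι e (U') - cvNVr' d L mv kk r hL a' ι e (U'))) (covLapM (bshiftEquiv (cvM d L mv kk hL) (L ^ kk)) η (gaugePair (bshiftEquiv (cvM d L mv kk hL) (L ^ kk)) (fun μ x => coordMat e (ContinuousLinearMap.mulLeftRight ℝ (Matrix mm mm ℂ) (U μ x) (U μ x)ᴴ))) + (cvNL d L mv kk hL a ι - cvNVq d L mv kk hL a ι e (U) - cvNVr d L mv kk hL a ι e (U))) ∘ₗ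
        mmulOp (fun p : CvX d L mv kk hL => (coordMat e (ContinuousLinearMap.mulLeftRight ℝ (Matrix mm mm ℂ) (u₀ p.1) (u₀ p.1)ᴴ))ᵀ) := by
  rw [← cvOp'_gauge e mv kk r hL a' η' he hu' U', ← cvOp_gauge e mv kk hL a η he hu U]
  have hW := fun p : CvX d L mv kk hL => uN_coordMat_conj_orthogonal e he (hu p.1)
  have hW' := fun p : CvX' d L mv kk r hL => uN_coordMat_conj_orthogonal e he (hu' p.1)
  exact idef_conj τ₁ τ₂ _ _ _ _ _ _ _ _
    (mmulOp_transpose_comp (fun p : CvX' d L mv kk r hL => coordMat e (ContinuousLinearMap.mulLeftRight ℝ (Matrix mm mm ℂ) (u₀' p.1) (u₀' p.1)ᴴ)) (fun p => (hW' p).1))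
    (mmulOp_transpose_comp (fun p : CvX d L mv kk hL => coordMat e (ContinuousLinearMap.mulLeftRight ℝ (Matrix mm mm ℂ) (u₀ p.1) (u₀ p.1)ᴴ)) (fun p => (hW p).1))

/-- ★★★ **BLOCK MAJORANTS OF THE OPERATOR DEFECT ARE GAUGE-INVARIANT UP TO `|ι|²`**: a row `HasMaj b_c b_f (𝔇_τ(A′(U′), A(U))) K` (`K ≥ 0`; coarse bond blocks `CvNorm`, fine bond blocks
through `kingPrV`) gives the row `|ι|²·K` for the gauge-twisted data `(U′^{u′}, U^{u}, M_{W′}τᵢM_{Wᵀ})` (§3 + the entry bound `|W_{ij}| ≤ 1` of orthogonal colour matrices). So the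
«consistency» input of n15-c∕328 may be produced in any paired gauge — in particular box by box in the cube gauge pair of `Reg335Cube`. [cite: Balaban1985BackgroundPropagators,
(3.34)–(3.35) p.396, Thm 3.14 pp.426–427 (shape)] -/
theorem hasMaj_idef_cvOp_gauge (mv kk r : ℕ) (hL : Odd L ∧ 1 < L) (a η a' η' : ℝ) (he : ∀ A B : Matrix mm mm ℂ, traceForm A B = e A ⬝ᵥ e B)
    {u₀ : ScX d L mv kk hL → Matrix mm mm ℂ} (hu : ∀ x, (u₀ x)ᴴ * u₀ x = 1) (U : Fin (d + 1) → CvX d L mv kk hL → Matrix mm mm ℂ)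
    {u₀' : ScX' d L mv kk r hL → Matrix mm mm ℂ} (hu' : ∀ x, (u₀' x)ᴴ * u₀' x = 1) (U' : Fin (d + 1) → CvX' d L mv kk r hL → Matrix mm mm ℂ)
    (τ₁ τ₂ : (CvX d L mv kk hL × ι → ℝ) →ₗ[ℝ] (CvX' d L mv kk r hL × ι → ℝ)) {K : Tor (cvM d L mv kk hL) → Tor (cvM d L mv kk hL) → ℝ} (hK : ∀ y y', 0 ≤ K y y')
    (h : HasMaj (CvNorm d L mv kk hL ι) (BlockNorm.ofBlocks (unitTorusGeo L kk (cvM d L mv kk hL)) (liftBlk (cvBlk d L mv kk hL ∘ kingPrV L kk r (cvM d L mv kk hL)) ι))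
      (idef τ₁ τ₂ (covLapM (bshiftEquiv (cvM d L mv kk hL) (L ^ r * L ^ kk)) η' (gaugePair (bshiftEquiv (cvM d L mv kk hL) (L ^ r * L ^ kk)) (fun μ x => coordMat e (ContinuousLinearMap.mulLeftRight ℝ (Matrix mm mm ℂ) (U' μ x) (U' μ x)ᴴ))) + (cvNL' d L mv kk r hL a' ι - cvNVq' d L mv kk r hL a' ι e (U') - cvNVr' d L mv kk r hL a' ι e (U'))) (covLapM (bshiftEquiv (cvM d L mv kk hL) (L ^ kk)) η (gaugePair (bshiftEquiv (cvM d L mv kk hL) (L ^ kk)) (fun μ x => coordMat e (ContinuousLinearMap.mulLeftRight ℝ (Matrix mm mm ℂ) (U μ x) (U μ x)ᴴ))) + (cvNL d L mv kk hL a ι - cvNVq d L mv kk hL a ι e (U) - cvNVr d L mv kk hL a ι e (U)))) K) :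
    HasMaj (CvNorm d L mv kk hL ι) (BlockNorm.ofBlocks (unitTorusGeo L kk (cvM d L mv kk hL)) (liftBlk (cvBlk d L mv kk hL ∘ kingPrV L kk r (cvM d L mv kk hL)) ι))
      (idef (mmulOp (fun p : CvX' d L mv kk r hL => coordMat e (ContinuousLinearMap.mulLeftRight ℝ (Matrix mm mm ℂ) (u₀' p.1) (u₀' p.1)ᴴ)) ∘ₗ τ₁ ∘ₗ mmulOp (fun p : CvX d L mv kk hL => (coordMat e (ContinuousLinearMap.mulLeftRight ℝ (Matrix mm mm ℂ) (u₀ p.1) (u₀ p.1)ᴴ))ᵀ)) (mmulOp (fun p : CvX' d L mv kk r hL => coordMat e (ContinuousLinearMap.mulLeftRight ℝ (Matrix mm mm ℂ) (u₀' p.1) (u₀' p.1)ᴴ)) ∘ₗ τ₂ ∘ₗ mmulOp (fun p : CvX d L mv kk hL => (coordMat e (ContinuousLinearMap.mulLeftRight ℝ (Matrix mm mm ℂ) (u₀ p.1) (u₀ p.1)ᴴ))ᵀ))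
        (covLapM (bshiftEquiv (cvM d L mv kk hL) (L ^ r * L ^ kk)) η' (gaugePair (bshiftEquiv (cvM d L mv kk hL) (L ^ r * L ^ kk)) (fun μ x => coordMat e (ContinuousLinearMap.mulLeftRight ℝ (Matrix mm mm ℂ) ((fun μ p => u₀' p.1 * U' μ p * (u₀' ((bshiftEquiv (cvM d L mv kk hL) (L ^ r * L ^ kk)) μ p).1)ᴴ) μ x) ((fun μ p => u₀' p.1 * U' μ p * (u₀' ((bshiftEquiv (cvM d L mv kk hL) (L ^ r * L ^ kk)) μ p).1)ᴴ) μ x)ᴴ))) + (cvNL' d L mv kk r hL a' ι - cvNVq' d L mv kk r hL a' ι e ((fun μ p => u₀' p.1 * U' μ p * (u₀' ((bshiftEquiv (cvM d L mv kk hL) (L ^ r * L ^ kk)) μ p).1)ᴴ)) - cvNVr' d L mv kk r hL a' ι e ((fun μ p => u₀' p.1 * U' μ p * (u₀' ((bshiftEquiv (cvM d L mv kk hL) (L ^ r * L ^ kk)) μ p).1)ᴴ))))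
        (covLapM (bshiftEquiv (cvM d L mv kk hL) (L ^ kk)) η (gaugePair (bshiftEquiv (cvM d L mv kk hL) (L ^ kk)) (fun μ x => coordMat e (ContinuousLinearMap.mulLeftRight ℝ (Matrix mm mm ℂ) ((fun μ p => u₀ p.1 * U μ p * (u₀ ((bshiftEquiv (cvM d L mv kk hL) (L ^ kk)) μ p).1)ᴴ) μ x) ((fun μ p => u₀ p.1 * U μ p * (u₀ ((bshiftEquiv (cvM d L mv kk hL) (L ^ kk)) μ p).1)ᴴ) μ x)ᴴ))) + (cvNL d L mv kk hL a ι - cvNVq d L mv kk hL a ι e ((fun μ p => u₀ p.1 * U μ p * (u₀ ((bshiftEquiv (cvM d L mv kk hL) (L ^ kk)) μ p).1)ᴴ)) - cvNVr d L mv kk hL a ι e ((fun μ p => u₀ p.1 * U μ p * (u₀ ((bshiftEquiv (cvM d L mv kk hL) (L ^ kk)) μ p).1)ᴴ)))))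
      (fun y y' => (Fintype.card ι : ℝ) ^ 2 * K y y') := by
  rw [idef_cvOp_gauge e mv kk r hL a η a' η' he hu U hu' U' τ₁ τ₂]
  have hW := fun p : CvX d L mv kk hL => uN_coordMat_conj_orthogonal e he (hu p.1)
  have hW' := fun p : CvX' d L mv kk r hL => uN_coordMat_conj_orthogonal e he (hu' p.1)
  have h1 := hasMaj_comp_mmulOp_of_entry_le_one (g := unitTorusGeo L kk (cvM d L mv kk hL)) (cvBlk d L mv kk hL) hK
    (fun p i j => CurvedSpecies.transpose_entry_le_one_of_orthogonal (fun p => (hW p).1) p i j) h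
  refine (hasMaj_mmulOp_comp_of_entry_le_one (g := unitTorusGeo L kk (cvM d L mv kk hL)) (cvBlk d L mv kk hL ∘ kingPrV L kk r (cvM d L mv kk hL))
    (fun p i j => entry_le_one_of_orthogonal (fun p => (hW' p).2) p i j) h1).mono fun y y' => le_of_eq ?_
  ring

end Defect

end Summit.QuantumFields.YangMills.BalabanUVNodes.N15.Gluing
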